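import Mathlib
import Literature.Analysis.Convex.DiscreteHardyInequality
import HarnessLib

/-!
# Copson's weighted Hardy inequality, exponent `p = 2` (finite sections)

**Copson's inequality** (the weighted form of Hardy's inequality for series; E. T. Copson 1927):
if `p > 1`, `aᵢ ≥ 0`, `wᵢ > 0` and `𝔄ᵢ(a; w) = (w₁a₁ + ⋯ + wᵢaᵢ) / (w₁ + ⋯ + wᵢ)` are the weighted
means, then
`∑ᵢ wᵢ 𝔄ᵢ(a; w)^p ≤ (p / (p - 1))^p ∑ᵢ wᵢ aᵢ^p`
[cite: Bullen1998, Hardy's Inequality, Extensions (b) (Copson), eq. (3)] (in the source with `<` unless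
all `aᵢ` vanish; `w ≡ 1` is Hardy's inequality, in-tree `DiscreteHardyInequality.lean`,
[cite: HardyLittlewoodPolya1952, Theorem 326]).  We formalise the case `p = 2` (constant `4`),
for FINITE sections and arbitrary real `aᵢ` (for `p = 2` the signs play no role), in a
division-free form: the means `mₖ` are any reals with `Wₖ mₖ = Tₖ`, `Wₖ = ∑_{j ≤ k} wⱼ`,
`Tₖ = ∑_{j ≤ k} wⱼ aⱼ` (so zero weights are allowed; where `Wₖ = 0` the term `wₖ mₖ²` vanishes).

Proof (the `p = 2` telescoping): with `wₖ aₖ = Wₖ mₖ - Wₖ₋₁ mₖ₋₁`,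
`∑_{k ≤ n} (wₖ mₖ² - 2 wₖ mₖ aₖ) ≤ -Wₙ mₙ² ≤ 0` by induction on `n` (the increment is
`-Wₙ₋₁ (mₙ₋₁ - mₙ)²`), whence `S := ∑ wₖ mₖ² ≤ 2 ∑ wₖ mₖ aₖ ≤ 2 S^{1/2} (∑ wₖ aₖ²)^{1/2}` by the
Cauchy–Schwarz inequality, i.e. `S ≤ 4 ∑ wₖ aₖ²`.

* `sum_mul_sq_le_four_mul_sum` — HEAD form (means over `j ≤ k`), division-free;
* `sum_mul_headMean_sq_le` — the same for the actual weighted means `Tₖ / Wₖ`;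
* `sum_mul_sq_le_four_mul_sum_tail`, `sum_mul_tailMean_sq_le` — TAIL form (means over
  `k ≤ j < K`, the form met when a decreasing nest of sets `Q₀ ⊇ Q₁ ⊇ ⋯` is cut into annuli:
  `∫_{Q_k} h = ∑_{j ≥ k} ∫_{A_j} h`), obtained from the head form by reflecting the indices.

Indexing starts at `0`; sections are `k < K`.

General exponent `1 < p` (`aₖ ≥ 0`, means `mₖ ≥ 0`, real powers `Real.rpow`), by Elliott's
telescoping with weights — `wₖ mₖ^p - (p/(p-1)) wₖ aₖ mₖ^{p-1} ≤ (p-1)⁻¹ (Wₖ₋₁ mₖ₋₁^p - Wₖ mₖ^p)`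
(Young's inequality `x^{p-1} y ≤ ((p-1)/p) x^p + (1/p) y^p`) — and Hölder:
* `sum_mul_rpow_le_rpow_mul_sum` (head, division-free), `sum_mul_headMean_rpow_le` (means),
* `sum_mul_rpow_le_rpow_mul_sum_tail`, `sum_mul_tailMean_rpow_le` (tail forms),
* `summable_mul_headMean_rpow`, `tsum_mul_headMean_rpow_le` (the series form, eq. (3) verbatim),
all with the constant `(p/(p-1))^p` of [cite: Bullen1998, Hardy's Inequality, Extensions (b) (Copson), eq. (3)].
-/

open Finset

noncomputable section

namespace Literature.Analysis.Convex.CopsonWeightedHardy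

/-- The telescoping step of Copson's inequality for `p = 2`: if `Wₖ mₖ = Tₖ` for `k ≤ n`
(`W`, `T` the head partial sums of `w ≥ 0` and of `w a`), then
`∑_{k ≤ n} (wₖ mₖ² - 2 wₖ mₖ aₖ) ≤ -Wₙ mₙ²`. [folklore] -/
private theorem sum_sub_two_mul_le {w a m : ℕ → ℝ} (hw : ∀ k, 0 ≤ w k) (n : ℕ)
    (hm : ∀ k, k ≤ n → (∑ j ∈ range (k + 1), w j) * m k = ∑ j ∈ range (k + 1), w j * a j) :
    ∑ k ∈ range (n + 1), (w k * m k ^ 2 - 2 * (w k * m k * a k)) ≤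
      -((∑ j ∈ range (n + 1), w j) * m n ^ 2) := by
  induction n with
  | zero =>
    have h0 := hm 0 le_rfl
    simp only [zero_add, sum_range_one] at h0 ⊢
    have e : w 0 * m 0 * a 0 = m 0 * (w 0 * m 0) := by linear_combination (-(m 0)) * h0
    nlinarith [e]
  | succ n ih =>
    have ih' := ih fun k hk => hm k (hk.trans (Nat.le_succ n))
    have hWn : 0 ≤ ∑ j ∈ range (n + 1), w j := sum_nonneg fun j _ => hw j
    have hn := hm n (Nat.le_succ n)
    have hn1 := hm (n + 1) le_rfl
    rw [sum_range_succ _ (n + 1), sum_range_succ (fun j => w j * a j) (n + 1)] at hn1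
    -- `w (n+1) a (n+1) = W (n+1) m (n+1) - W n m n`, multiplied by `m (n+1)`
    have e : w (n + 1) * m (n + 1) * a (n + 1) =
        m (n + 1) * ((∑ j ∈ range (n + 1), w j + w (n + 1)) * m (n + 1)) -
          m (n + 1) * ((∑ j ∈ range (n + 1), w j) * m n) := by
      linear_combination (m (n + 1)) * hn - (m (n + 1)) * hn1
    have hsq : 0 ≤ (∑ j ∈ range (n + 1), w j) * (m n - m (n + 1)) ^ 2 :=
      mul_nonneg hWn (sq_nonneg _)
    rw [sum_range_succ _ (n + 1), sum_range_succ _ (n + 1)]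
    nlinarith [ih', e, hsq]

/-- **Copson's weighted Hardy inequality, `p = 2`, head form (division-free).** For weights
`wₖ ≥ 0`, reals `aₖ`, and any `mₖ` with `(∑_{j ≤ k} wⱼ) mₖ = ∑_{j ≤ k} wⱼ aⱼ` for `k < K`:
`∑_{k < K} wₖ mₖ² ≤ 4 ∑_{k < K} wₖ aₖ²` (Copson 1927; Bullen 1998, *Hardy's Inequality*,
Extensions (b), eq. (3) with `p = 2`). [cite: Bullen1998, Hardy's Inequality, Extensions (b) (Copson), eq. (3)] -/
theorem sum_mul_sq_le_four_mul_sum {w a m : ℕ → ℝ} (hw : ∀ k, 0 ≤ w k) (K : ℕ)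
    (hm : ∀ k, k < K → (∑ j ∈ range (k + 1), w j) * m k = ∑ j ∈ range (k + 1), w j * a j) :
    ∑ k ∈ range K, w k * m k ^ 2 ≤ 4 * ∑ k ∈ range K, w k * a k ^ 2 := by
  rcases Nat.eq_zero_or_pos K with hK | hK
  · subst hK; simp
  obtain ⟨n, rfl⟩ : ∃ n, K = n + 1 := ⟨K - 1, (Nat.sub_add_cancel hK).symm⟩
  set S := ∑ k ∈ range (n + 1), w k * m k ^ 2 with hS
  set A := ∑ k ∈ range (n + 1), w k * a k ^ 2 with hA
  set B := ∑ k ∈ range (n + 1), w k * m k * a k with hB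
  have hS0 : 0 ≤ S := sum_nonneg fun k _ => mul_nonneg (hw k) (sq_nonneg _)
  have hA0 : 0 ≤ A := sum_nonneg fun k _ => mul_nonneg (hw k) (sq_nonneg _)
  -- `S ≤ 2 B` (telescoping)
  have hkey := sum_sub_two_mul_le hw n fun k hk => hm k (Nat.lt_succ_of_le hk)
  have hWn : 0 ≤ (∑ j ∈ range (n + 1), w j) * m n ^ 2 :=
    mul_nonneg (sum_nonneg fun j _ => hw j) (sq_nonneg _)
  have hSB : S ≤ 2 * B := by
    rw [sum_sub_distrib, ← mul_sum] at hkey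
    linarith
  -- Cauchy–Schwarz: `B² ≤ S A`
  have hCS : B ^ 2 ≤ S * A := by
    have h := sum_mul_sq_le_sq_mul_sq (range (n + 1)) (fun k => Real.sqrt (w k) * m k)
      (fun k => Real.sqrt (w k) * a k)
    have e1 : ∀ k, Real.sqrt (w k) * m k * (Real.sqrt (w k) * a k) = w k * m k * a k := by
      intro k
      have := Real.mul_self_sqrt (hw k)
      linear_combination (m k * a k) * this
    have e2 : ∀ k, (Real.sqrt (w k) * m k) ^ 2 = w k * m k ^ 2 := by
      intro k; rw [mul_pow, Real.sq_sqrt (hw k)]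
    have e3 : ∀ k, (Real.sqrt (w k) * a k) ^ 2 = w k * a k ^ 2 := by
      intro k; rw [mul_pow, Real.sq_sqrt (hw k)]
    simp only [e1, e2, e3] at h
    exact h
  -- conclude
  by_cases hS' : S = 0
  · rw [hS']; positivity
  have hSpos : 0 < S := lt_of_le_of_ne hS0 (Ne.symm hS')
  nlinarith [hSB, hCS, mul_le_mul_of_nonneg_left hSB hS0]

/-- **Copson's weighted Hardy inequality, `p = 2`, head form, for the weighted means**
`𝔄ₖ = (∑_{j ≤ k} wⱼ aⱼ) / (∑_{j ≤ k} wⱼ)` (junk `0` where the weight sum vanishes, which for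
`w ≥ 0` forces `wₖ = 0`): `∑_{k < K} wₖ 𝔄ₖ² ≤ 4 ∑_{k < K} wₖ aₖ²`
(Bullen 1998, *Hardy's Inequality*, Extensions (b), eq. (3), `p = 2`). [cite: Bullen1998, Hardy's Inequality, Extensions (b) (Copson), eq. (3)] -/
theorem sum_mul_headMean_sq_le {w a : ℕ → ℝ} (hw : ∀ k, 0 ≤ w k) (K : ℕ) :
    ∑ k ∈ range K, w k * ((∑ j ∈ range (k + 1), w j * a j) / ∑ j ∈ range (k + 1), w j) ^ 2 ≤
      4 * ∑ k ∈ range K, w k * a k ^ 2 := by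
  refine sum_mul_sq_le_four_mul_sum hw K fun k _ => ?_
  by_cases hW : ∑ j ∈ range (k + 1), w j = 0
  · -- all weights `wⱼ`, `j ≤ k`, vanish
    have hw0 : ∀ j ∈ range (k + 1), w j = 0 :=
      (sum_eq_zero_iff_of_nonneg fun j _ => hw j).1 hW
    rw [hW, zero_mul]
    exact (sum_eq_zero fun j hj => by rw [hw0 j hj, zero_mul]).symm
  · exact mul_div_cancel₀ _ hW

/-- **Copson's weighted Hardy inequality, `p = 2`, tail form (division-free).** For weights
`wₖ ≥ 0`, reals `aₖ`, and any `mₖ` with `(∑_{k ≤ j < K} wⱼ) mₖ = ∑_{k ≤ j < K} wⱼ aⱼ` for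
`k < K`: `∑_{k < K} wₖ mₖ² ≤ 4 ∑_{k < K} wₖ aₖ²` — the head form for the reflected sequences
`j ↦ K - 1 - j` (Bullen 1998, *Hardy's Inequality*, Extensions (b), eq. (3), `p = 2`; cf. the
tail-sum inequality *Copson's Inequality* ibid.). [cite: Bullen1998, Hardy's Inequality, Extensions (b) (Copson), eq. (3)] -/
theorem sum_mul_sq_le_four_mul_sum_tail {w a m : ℕ → ℝ} (hw : ∀ k, 0 ≤ w k) (K : ℕ)
    (hm : ∀ k, k < K → (∑ j ∈ Ico k K, w j) * m k = ∑ j ∈ Ico k K, w j * a j) :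
    ∑ k ∈ range K, w k * m k ^ 2 ≤ 4 * ∑ k ∈ range K, w k * a k ^ 2 := by
  rcases Nat.eq_zero_or_pos K with hK | hK
  · subst hK; simp
  obtain ⟨n, rfl⟩ : ∃ n, K = n + 1 := ⟨K - 1, (Nat.sub_add_cancel hK).symm⟩
  -- reflected sequences
  have h := sum_mul_sq_le_four_mul_sum (w := fun j => w (n - j)) (a := fun j => a (n - j))
    (m := fun j => m (n - j)) (fun k => hw _) (n + 1) ?_
  · have e1 : ∑ k ∈ range (n + 1), w (n - k) * m (n - k) ^ 2 =
        ∑ k ∈ range (n + 1), w k * m k ^ 2 := by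
      have := sum_range_reflect (fun k => w k * m k ^ 2) (n + 1)
      simpa only [add_tsub_cancel_right] using this
    have e2 : ∑ k ∈ range (n + 1), w (n - k) * a (n - k) ^ 2 =
        ∑ k ∈ range (n + 1), w k * a k ^ 2 := by
      have := sum_range_reflect (fun k => w k * a k ^ 2) (n + 1)
      simpa only [add_tsub_cancel_right] using this
    rw [e1, e2] at h
    exact h
  · intro k hk
    have hk' : n - k < n + 1 := Nat.lt_succ_of_le (Nat.sub_le n k)
    have r1 : ∑ j ∈ range (k + 1), w (n - j) = ∑ j ∈ Ico (n - k) (n + 1), w j := by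
      rw [range_eq_Ico, sum_Ico_reflect _ 0 (Nat.succ_le_of_lt hk)]
      congr 1
      simp only [tsub_zero, Nat.succ_sub_succ_eq_sub]
    have r2 : ∑ j ∈ range (k + 1), w (n - j) * a (n - j) =
        ∑ j ∈ Ico (n - k) (n + 1), w j * a j := by
      rw [range_eq_Ico, sum_Ico_reflect (fun j => w j * a j) 0 (Nat.succ_le_of_lt hk)]
      congr 1
      simp only [tsub_zero, Nat.succ_sub_succ_eq_sub]
    rw [r1, r2]
    exact hm (n - k) hk'

/-- **Copson's weighted Hardy inequality, `p = 2`, tail form, for the weighted tail means**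
`𝔄ₖ = (∑_{k ≤ j < K} wⱼ aⱼ) / (∑_{k ≤ j < K} wⱼ)` (junk `0` where the weight sum vanishes):
`∑_{k < K} wₖ 𝔄ₖ² ≤ 4 ∑_{k < K} wₖ aₖ²`
(Bullen 1998, *Hardy's Inequality*, Extensions (b), eq. (3), `p = 2`, reflected). [cite: Bullen1998, Hardy's Inequality, Extensions (b) (Copson), eq. (3)] -/
theorem sum_mul_tailMean_sq_le {w a : ℕ → ℝ} (hw : ∀ k, 0 ≤ w k) (K : ℕ) :
    ∑ k ∈ range K, w k * ((∑ j ∈ Ico k K, w j * a j) / ∑ j ∈ Ico k K, w j) ^ 2 ≤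
      4 * ∑ k ∈ range K, w k * a k ^ 2 := by
  refine sum_mul_sq_le_four_mul_sum_tail hw K fun k _ => ?_
  by_cases hW : ∑ j ∈ Ico k K, w j = 0
  · have hw0 : ∀ j ∈ Ico k K, w j = 0 :=
      (sum_eq_zero_iff_of_nonneg fun j _ => hw j).1 hW
    rw [hW, zero_mul]
    exact (sum_eq_zero fun j hj => by rw [hw0 j hj, zero_mul]).symm
  · exact mul_div_cancel₀ _ hW

section GeneralExponent

open Real

/-- Weighted Elliott telescoping for a general exponent `1 < p`: if `Wₖ mₖ = Tₖ` for `k ≤ n`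
(`mₖ ≥ 0`), then `∑_{k ≤ n} (wₖ mₖ^p - (p/(p-1)) wₖ aₖ mₖ^{p-1}) ≤ -(p-1)⁻¹ Wₙ mₙ^p`. [folklore] -/
private theorem sum_rpow_sub_le {w a m : ℕ → ℝ} (hw : ∀ k, 0 ≤ w k) (hm0 : ∀ k, 0 ≤ m k)
    {p : ℝ} (hp : 1 < p) (n : ℕ)
    (hm : ∀ k, k ≤ n → (∑ j ∈ range (k + 1), w j) * m k = ∑ j ∈ range (k + 1), w j * a j) :
    ∑ k ∈ range (n + 1), (w k * m k ^ p - p / (p - 1) * (w k * a k * m k ^ (p - 1))) ≤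
      -((p - 1)⁻¹ * ((∑ j ∈ range (n + 1), w j) * m n ^ p)) := by
  have hp1 : 0 < p - 1 := by linarith
  have hp0 : 0 < p := by linarith
  have hp1' : p - 1 ≠ 0 := hp1.ne'
  have hp0' : p ≠ 0 := hp0.ne'
  have hpow : ∀ x : ℝ, 0 ≤ x → x ^ (p - 1) * x = x ^ p := fun x hx => by
    conv_lhs => rw [← rpow_one x, ← rpow_mul hx, one_mul, ← rpow_add' hx (by linarith)]
    simp
  induction n with
  | zero =>
    have h0 := hm 0 le_rfl
    simp only [zero_add, sum_range_one] at h0 ⊢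
    have e : w 0 * a 0 * m 0 ^ (p - 1) = w 0 * m 0 ^ p := by
      rw [← h0, mul_assoc, mul_comm (m 0), hpow _ (hm0 0)]
    rw [e]
    have : w 0 * m 0 ^ p - p / (p - 1) * (w 0 * m 0 ^ p) = -((p - 1)⁻¹ * (w 0 * m 0 ^ p)) := by
      field_simp
      ring
    rw [this]
  | succ n ih =>
    have ih' := ih fun k hk => hm k (hk.trans (Nat.le_succ n))
    have hWn : 0 ≤ ∑ j ∈ range (n + 1), w j := sum_nonneg fun j _ => hw j
    have hn := hm n (Nat.le_succ n)
    have hn1 := hm (n + 1) le_rfl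
    rw [sum_range_succ _ (n + 1), sum_range_succ (fun j => w j * a j) (n + 1)] at hn1
    have hyoung : m (n + 1) ^ (p - 1) * m n ≤ (p - 1) / p * m (n + 1) ^ p + 1 / p * m n ^ p :=
      DiscreteHardyInequality.rpow_sub_one_mul_le hp (hm0 _) (hm0 _)
    -- the new term: `w a m^{p-1} = m^{p-1} (W' m - W₀ m₀) = W' m^p - W₀ m^{p-1} m₀`
    have e : w (n + 1) * a (n + 1) * m (n + 1) ^ (p - 1) =
        (∑ j ∈ range (n + 1), w j + w (n + 1)) * m (n + 1) ^ p -
          (∑ j ∈ range (n + 1), w j) * (m (n + 1) ^ (p - 1) * m n) := by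
      have e1 : w (n + 1) * a (n + 1) =
          (∑ j ∈ range (n + 1), w j + w (n + 1)) * m (n + 1) -
            (∑ j ∈ range (n + 1), w j) * m n := by
        linarith [hn, hn1]
      rw [e1, ← hpow _ (hm0 (n + 1))]
      ring
    rw [sum_range_succ _ (n + 1), sum_range_succ _ (n + 1), e]
    have key : -((p - 1)⁻¹ * ((∑ j ∈ range (n + 1), w j) * m n ^ p)) +
          (w (n + 1) * m (n + 1) ^ p - p / (p - 1) *
            ((∑ j ∈ range (n + 1), w j + w (n + 1)) * m (n + 1) ^ p -
              (∑ j ∈ range (n + 1), w j) * (m (n + 1) ^ (p - 1) * m n))) +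
          (p - 1)⁻¹ * ((∑ j ∈ range (n + 1), w j + w (n + 1)) * m (n + 1) ^ p) =
        (∑ j ∈ range (n + 1), w j) * p / (p - 1) *
          (m (n + 1) ^ (p - 1) * m n - ((p - 1) / p * m (n + 1) ^ p + 1 / p * m n ^ p)) := by
      field_simp
      ring
    have hcoef : 0 ≤ (∑ j ∈ range (n + 1), w j) * p / (p - 1) := by positivity
    nlinarith [mul_nonneg hcoef (sub_nonneg.mpr hyoung), key, ih']

/-- **Copson's weighted Hardy inequality, general exponent `1 < p`, head form (division-free).**
For weights `wₖ ≥ 0`, `aₖ ≥ 0`, and `mₖ ≥ 0` with `(∑_{j ≤ k} wⱼ) mₖ = ∑_{j ≤ k} wⱼ aⱼ` (`k < K`):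
`∑_{k < K} wₖ mₖ^p ≤ (p/(p-1))^p ∑_{k < K} wₖ aₖ^p` (Copson 1927; Bullen 1998, *Hardy's Inequality*,
Extensions (b), eq. (3)). [cite: Bullen1998, Hardy's Inequality, Extensions (b) (Copson), eq. (3)] -/
theorem sum_mul_rpow_le_rpow_mul_sum {w a m : ℕ → ℝ} (hw : ∀ k, 0 ≤ w k) (ha : ∀ k, 0 ≤ a k)
    (hm0 : ∀ k, 0 ≤ m k) {p : ℝ} (hp : 1 < p) (K : ℕ)
    (hm : ∀ k, k < K → (∑ j ∈ range (k + 1), w j) * m k = ∑ j ∈ range (k + 1), w j * a j) :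
    ∑ k ∈ range K, w k * m k ^ p ≤ (p / (p - 1)) ^ p * ∑ k ∈ range K, w k * a k ^ p := by
  have hp1 : 0 < p - 1 := by linarith
  have hp0 : 0 < p := by linarith
  set q : ℝ := p / (p - 1) with hq_def
  have hq0 : 0 < q := by positivity
  set S : ℝ := ∑ k ∈ range K, w k * m k ^ p with hS_def
  set B : ℝ := ∑ k ∈ range K, w k * a k ^ p with hB_def
  set T : ℝ := ∑ k ∈ range K, w k * a k * m k ^ (p - 1) with hT_def
  have hS0 : 0 ≤ S := sum_nonneg fun k _ => mul_nonneg (hw k) (rpow_nonneg (hm0 k) _)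
  have hB0 : 0 ≤ B := sum_nonneg fun k _ => mul_nonneg (hw k) (rpow_nonneg (ha k) _)
  -- Step 1 (Elliott): `S ≤ q T`
  have h1 : S ≤ q * T := by
    rcases Nat.eq_zero_or_pos K with hK | hK
    · have hS : S = 0 := by rw [hS_def, hK, sum_range_zero]
      have hT : T = 0 := by rw [hT_def, hK, sum_range_zero]
      rw [hS, hT, mul_zero]
    obtain ⟨n, hn⟩ : ∃ n, K = n + 1 := ⟨K - 1, (Nat.sub_add_cancel hK).symm⟩
    have h := sum_rpow_sub_le hw hm0 hp n fun k hk => hm k (by omega)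
    rw [sum_sub_distrib, ← mul_sum, ← hn] at h
    have hneg : 0 ≤ (p - 1)⁻¹ * ((∑ j ∈ range K, w j) * m n ^ p) :=
      mul_nonneg (inv_nonneg.2 hp1.le)
        (mul_nonneg (sum_nonneg fun j _ => hw j) (rpow_nonneg (hm0 n) _))
    change S - q * T ≤ _ at h
    linarith
  -- Step 2 (Hölder, exponents `q` and `p`): `T ≤ S^{1/q} B^{1/p}`
  have hpq : p.HolderConjugate q := Real.HolderConjugate.conjExponent hp
  have hqp1 : 1 / q + 1 / p = 1 := by rw [hq_def]; field_simp; ring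
  have h2 : T ≤ S ^ (1 / q) * B ^ (1 / p) := by
    have h := inner_le_Lp_mul_Lq_of_nonneg (range K) hpq.symm
      (f := fun k => w k ^ (1 / q) * m k ^ (p - 1)) (g := fun k => w k ^ (1 / p) * a k)
      (fun k _ => mul_nonneg (rpow_nonneg (hw k) _) (rpow_nonneg (hm0 k) _))
      (fun k _ => mul_nonneg (rpow_nonneg (hw k) _) (ha k))
    have hT' : ∑ k ∈ range K, w k ^ (1 / q) * m k ^ (p - 1) * (w k ^ (1 / p) * a k) = T := by
      refine sum_congr rfl fun k _ => ?_
      have hw1 : w k ^ (1 / q) * w k ^ (1 / p) = w k := by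
        rw [← rpow_add' (hw k) (by rw [hqp1]; norm_num), hqp1, rpow_one]
      calc w k ^ (1 / q) * m k ^ (p - 1) * (w k ^ (1 / p) * a k)
          = w k ^ (1 / q) * w k ^ (1 / p) * a k * m k ^ (p - 1) := by ring
        _ = w k * a k * m k ^ (p - 1) := by rw [hw1]
    have hS' : ∑ k ∈ range K, (w k ^ (1 / q) * m k ^ (p - 1)) ^ q = S := by
      refine sum_congr rfl fun k _ => ?_
      rw [mul_rpow (rpow_nonneg (hw k) _) (rpow_nonneg (hm0 k) _), ← rpow_mul (hw k),
        ← rpow_mul (hm0 k), show 1 / q * q = 1 by field_simp, rpow_one]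
      congr 1
      rw [hq_def]; field_simp
    have hB' : ∑ k ∈ range K, (w k ^ (1 / p) * a k) ^ p = B := by
      refine sum_congr rfl fun k _ => ?_
      rw [mul_rpow (rpow_nonneg (hw k) _) (ha k), ← rpow_mul (hw k),
        show 1 / p * p = 1 by field_simp, rpow_one]
    rw [hT', hS', hB'] at h
    exact h
  -- Step 3: combine and divide by `S^{1/q}`
  by_cases hS : S = 0
  · rw [hS]; positivity
  have hSpos : 0 < S := lt_of_le_of_ne hS0 (Ne.symm hS)
  have h3 : S ≤ q * (S ^ (1 / q) * B ^ (1 / p)) := h1.trans (mul_le_mul_of_nonneg_left h2 hq0.le)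
  have hsplit : S = S ^ (1 / q) * S ^ (1 / p) := by
    rw [← rpow_add hSpos, hqp1, rpow_one]
  have h4 : S ^ (1 / p) ≤ q * B ^ (1 / p) := by
    have hSq : 0 < S ^ (1 / q) := rpow_pos_of_pos hSpos _
    have h3' : S ^ (1 / q) * S ^ (1 / p) ≤ S ^ (1 / q) * (q * B ^ (1 / p)) := by
      rw [← hsplit]; linarith
    exact le_of_mul_le_mul_left h3' hSq
  have h5 : (S ^ (1 / p)) ^ p ≤ (q * B ^ (1 / p)) ^ p :=
    rpow_le_rpow (rpow_nonneg hS0 _) h4 hp0.le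
  rw [← rpow_mul hS0, show 1 / p * p = 1 by field_simp, rpow_one,
    mul_rpow hq0.le (rpow_nonneg hB0 _), ← rpow_mul hB0, show 1 / p * p = 1 by field_simp,
    rpow_one] at h5
  exact h5

/-- **Copson's weighted Hardy inequality, general exponent `1 < p`, head form, for the weighted
means** `𝔄ₖ = (∑_{j ≤ k} wⱼ aⱼ) / (∑_{j ≤ k} wⱼ)` (`wₖ, aₖ ≥ 0`; junk `0` where the weight sum
vanishes): `∑_{k < K} wₖ 𝔄ₖ^p ≤ (p/(p-1))^p ∑_{k < K} wₖ aₖ^p`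
(Bullen 1998, *Hardy's Inequality*, Extensions (b), eq. (3)). [cite: Bullen1998, Hardy's Inequality, Extensions (b) (Copson), eq. (3)] -/
theorem sum_mul_headMean_rpow_le {w a : ℕ → ℝ} (hw : ∀ k, 0 ≤ w k) (ha : ∀ k, 0 ≤ a k) {p : ℝ}
    (hp : 1 < p) (K : ℕ) :
    ∑ k ∈ range K, w k * ((∑ j ∈ range (k + 1), w j * a j) / ∑ j ∈ range (k + 1), w j) ^ p ≤
      (p / (p - 1)) ^ p * ∑ k ∈ range K, w k * a k ^ p := by
  refine sum_mul_rpow_le_rpow_mul_sum hw ha (fun k => div_nonneg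
    (sum_nonneg fun j _ => mul_nonneg (hw j) (ha j)) (sum_nonneg fun j _ => hw j)) hp K
    fun k _ => ?_
  by_cases hW : ∑ j ∈ range (k + 1), w j = 0
  · have hw0 : ∀ j ∈ range (k + 1), w j = 0 :=
      (sum_eq_zero_iff_of_nonneg fun j _ => hw j).1 hW
    rw [hW, zero_mul]
    exact (sum_eq_zero fun j hj => by rw [hw0 j hj, zero_mul]).symm
  · exact mul_div_cancel₀ _ hW

/-- **Copson's weighted Hardy inequality, general exponent `1 < p`, tail form (division-free)**:
`wₖ, aₖ, mₖ ≥ 0`, `(∑_{k ≤ j < K} wⱼ) mₖ = ∑_{k ≤ j < K} wⱼ aⱼ` (`k < K`) ⇒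
`∑_{k < K} wₖ mₖ^p ≤ (p/(p-1))^p ∑_{k < K} wₖ aₖ^p` — the head form for the reflected sequences
(Bullen 1998, *Hardy's Inequality*, Extensions (b), eq. (3)). [cite: Bullen1998, Hardy's Inequality, Extensions (b) (Copson), eq. (3)] -/
theorem sum_mul_rpow_le_rpow_mul_sum_tail {w a m : ℕ → ℝ} (hw : ∀ k, 0 ≤ w k) (ha : ∀ k, 0 ≤ a k)
    (hm0 : ∀ k, 0 ≤ m k) {p : ℝ} (hp : 1 < p) (K : ℕ)
    (hm : ∀ k, k < K → (∑ j ∈ Ico k K, w j) * m k = ∑ j ∈ Ico k K, w j * a j) :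
    ∑ k ∈ range K, w k * m k ^ p ≤ (p / (p - 1)) ^ p * ∑ k ∈ range K, w k * a k ^ p := by
  rcases Nat.eq_zero_or_pos K with hK | hK
  · subst hK
    simp only [range_zero, sum_empty, mul_zero, le_refl]
  obtain ⟨n, rfl⟩ : ∃ n, K = n + 1 := ⟨K - 1, (Nat.sub_add_cancel hK).symm⟩
  have h := sum_mul_rpow_le_rpow_mul_sum (w := fun j => w (n - j)) (a := fun j => a (n - j))
    (m := fun j => m (n - j)) (fun k => hw _) (fun k => ha _) (fun k => hm0 _) hp (n + 1) ?_
  · have e1 : ∑ k ∈ range (n + 1), w (n - k) * m (n - k) ^ p =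
        ∑ k ∈ range (n + 1), w k * m k ^ p := by
      have := sum_range_reflect (fun k => w k * m k ^ p) (n + 1)
      simpa only [add_tsub_cancel_right] using this
    have e2 : ∑ k ∈ range (n + 1), w (n - k) * a (n - k) ^ p =
        ∑ k ∈ range (n + 1), w k * a k ^ p := by
      have := sum_range_reflect (fun k => w k * a k ^ p) (n + 1)
      simpa only [add_tsub_cancel_right] using this
    rw [e1, e2] at h
    exact h
  · intro k hk
    have hk' : n - k < n + 1 := Nat.lt_succ_of_le (Nat.sub_le n k)
    have r1 : ∑ j ∈ range (k + 1), w (n - j) = ∑ j ∈ Ico (n - k) (n + 1), w j := by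
      rw [range_eq_Ico, sum_Ico_reflect _ 0 (Nat.succ_le_of_lt hk)]
      congr 1
      simp only [tsub_zero, Nat.succ_sub_succ_eq_sub]
    have r2 : ∑ j ∈ range (k + 1), w (n - j) * a (n - j) =
        ∑ j ∈ Ico (n - k) (n + 1), w j * a j := by
      rw [range_eq_Ico, sum_Ico_reflect (fun j => w j * a j) 0 (Nat.succ_le_of_lt hk)]
      congr 1
      simp only [tsub_zero, Nat.succ_sub_succ_eq_sub]
    rw [r1, r2]
    exact hm (n - k) hk'

/-- **Copson's weighted Hardy inequality, general exponent `1 < p`, tail form, for the weighted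
tail means** `𝔄ₖ = (∑_{k ≤ j < K} wⱼ aⱼ) / (∑_{k ≤ j < K} wⱼ)` (`wₖ, aₖ ≥ 0`; junk `0` where the
weight sum vanishes): `∑_{k < K} wₖ 𝔄ₖ^p ≤ (p/(p-1))^p ∑_{k < K} wₖ aₖ^p`
(Bullen 1998, *Hardy's Inequality*, Extensions (b), eq. (3), reflected). [cite: Bullen1998, Hardy's Inequality, Extensions (b) (Copson), eq. (3)] -/
theorem sum_mul_tailMean_rpow_le {w a : ℕ → ℝ} (hw : ∀ k, 0 ≤ w k) (ha : ∀ k, 0 ≤ a k) {p : ℝ}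
    (hp : 1 < p) (K : ℕ) :
    ∑ k ∈ range K, w k * ((∑ j ∈ Ico k K, w j * a j) / ∑ j ∈ Ico k K, w j) ^ p ≤
      (p / (p - 1)) ^ p * ∑ k ∈ range K, w k * a k ^ p := by
  refine sum_mul_rpow_le_rpow_mul_sum_tail hw ha (fun k => div_nonneg
    (sum_nonneg fun j _ => mul_nonneg (hw j) (ha j)) (sum_nonneg fun j _ => hw j)) hp K
    fun k _ => ?_
  by_cases hW : ∑ j ∈ Ico k K, w j = 0
  · have hw0 : ∀ j ∈ Ico k K, w j = 0 :=
      (sum_eq_zero_iff_of_nonneg fun j _ => hw j).1 hW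
    rw [hW, zero_mul]
    exact (sum_eq_zero fun j hj => by rw [hw0 j hj, zero_mul]).symm
  · exact mul_div_cancel₀ _ hW

/-- If `∑ wₙ aₙ^p` converges (`wₙ, aₙ ≥ 0`, `1 < p`) then so does `∑ wₙ 𝔄ₙ^p` for the weighted head
means `𝔄ₙ = (∑_{j ≤ n} wⱼ aⱼ)/(∑_{j ≤ n} wⱼ)`. [cite: Bullen1998, Hardy's Inequality, Extensions (b) (Copson), eq. (3)] -/
theorem summable_mul_headMean_rpow {w a : ℕ → ℝ} (hw : ∀ k, 0 ≤ w k) (ha : ∀ k, 0 ≤ a k) {p : ℝ}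
    (hp : 1 < p) (hs : Summable fun n => w n * a n ^ p) :
    Summable fun n => w n * ((∑ j ∈ range (n + 1), w j * a j) / ∑ j ∈ range (n + 1), w j) ^ p := by
  have hmean0 : ∀ n, 0 ≤ (∑ j ∈ range (n + 1), w j * a j) / ∑ j ∈ range (n + 1), w j := fun n =>
    div_nonneg (sum_nonneg fun j _ => mul_nonneg (hw j) (ha j)) (sum_nonneg fun j _ => hw j)
  refine summable_of_sum_range_le (fun n => mul_nonneg (hw n) (rpow_nonneg (hmean0 n) _))
    (c := (p / (p - 1)) ^ p * ∑' n, w n * a n ^ p) fun N => ?_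
  refine (sum_mul_headMean_rpow_le hw ha hp N).trans ?_
  exact mul_le_mul_of_nonneg_left
    (hs.sum_le_tsum _ fun n _ => mul_nonneg (hw n) (rpow_nonneg (ha n) _))
    (rpow_nonneg (div_nonneg (by linarith) (by linarith)) _)

/-- **Copson's weighted Hardy inequality for series** (`1 < p`, `wₙ, aₙ ≥ 0`, `∑ wₙ aₙ^p < ∞`):
`∑ₙ wₙ 𝔄ₙ(a; w)^p ≤ (p/(p-1))^p ∑ₙ wₙ aₙ^p`, `𝔄ₙ(a; w) = (w₀a₀ + ⋯ + wₙaₙ)/(w₀ + ⋯ + wₙ)` — the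
displayed inequality (3) of Bullen 1998, *Hardy's Inequality*, Extensions (b) [Copson] (non-strict
form; indices from `0`; zero weights allowed). [cite: Bullen1998, Hardy's Inequality, Extensions (b) (Copson), eq. (3)] -/
theorem tsum_mul_headMean_rpow_le {w a : ℕ → ℝ} (hw : ∀ k, 0 ≤ w k) (ha : ∀ k, 0 ≤ a k) {p : ℝ}
    (hp : 1 < p) (hs : Summable fun n => w n * a n ^ p) :
    ∑' n, w n * ((∑ j ∈ range (n + 1), w j * a j) / ∑ j ∈ range (n + 1), w j) ^ p ≤
      (p / (p - 1)) ^ p * ∑' n, w n * a n ^ p := by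
  have hmean0 : ∀ n, 0 ≤ (∑ j ∈ range (n + 1), w j * a j) / ∑ j ∈ range (n + 1), w j := fun n =>
    div_nonneg (sum_nonneg fun j _ => mul_nonneg (hw j) (ha j)) (sum_nonneg fun j _ => hw j)
  refine Real.tsum_le_of_sum_range_le (fun n => mul_nonneg (hw n) (rpow_nonneg (hmean0 n) _))
    fun N => ?_
  refine (sum_mul_headMean_rpow_le hw ha hp N).trans ?_
  exact mul_le_mul_of_nonneg_left
    (hs.sum_le_tsum _ fun n _ => mul_nonneg (hw n) (rpow_nonneg (ha n) _))
    (rpow_nonneg (div_nonneg (by linarith) (by linarith)) _)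

end GeneralExponent

end Literature.Analysis.Convex.CopsonWeightedHardy

end
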